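import Literature.AlgebraicGeometry.Motives.MumfordTateGroupOfOrientationVersusHodgeGroup
import Literature.AlgebraicGeometry.Motives.CyclotomicFieldTwentyFourOrientation
import HarnessLib

/-!
# On `ℚ(ζ₂₄)`: a CY-type weight-three SCMpHS `V` with `MT(V)(ℂ) < MT(J_G(V))(ℂ)` and `Hg(V)(ℂ) < Hg(J_G(V))(ℂ)` — GGK's Question (V.A.10)
# at the level of Mumford–Tate groups, unconditionally on an honest cyclotomic field

[topic AlgebraicGeometry/Motives]

Layer `Literature/AlgebraicGeometry/Motives`, lane `lit-hodgefound` (Track 2 foundations library; seat `lit-hodgefound-p02`, gen 27,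
row g27-#11).  THEOREMS ONLY (no definition, no named fact; net debt `0`).  The instantiation on `F = ℚ(ζ₂₄)` (p02's g26-#10
`Motives/CyclotomicFieldTwentyFourOrientation`: `galEquiv : Gal(ℚ(ζ₂₄)/ℚ) ≃* (ℤ/2)³`, `galEquiv_conjGal`) of g27-#9
`Motives/MumfordTateGroupOfOrientationQuestionVA10` (`MT(V³_{(L,Π)})(ℂ) < MT(V¹_{(L,Θ^G_Π)})(ℂ)`) and g27-#10
`Motives/MumfordTateGroupOfOrientationVersusHodgeGroup` (`Hg(V³_{(L,Π)})(ℂ) < Hg(V¹_{(L,Θ^G_Π)})(ℂ)`), in the existential style of g26-#10.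

THE PRINTS.  GGK [GreenGriffithsKerr2012] (V.A.10) p. 158 «Question: If `Θ ∈ Θ(Π)` as in (V.A.2), is `𝓡(F,Π) ≥ 𝓡(F,Θ)`?»; (V.A.4) p. 156
(`ℚ(ζ₂₄)`-type examples); (V.D.5) p. 164, (V.D.7)–(V.D.8) pp. 165–166 (Mumford–Tate groups of `V` versus those of the related weight-one
structures; «Abdulali's abelian variety need not be nondegenerate when the SCMpHS `V` is» — here the opposite phenomenon).

WHAT IS PROVED (`[HodgeTensorFacts.{0,0}]`; `K24 = CyclotomicField 24 ℚ`).
* **`exists_orientation_mumfordTateGroupBaseChange_lt`** — there are an effective `3`-orientation `Π` of `ℚ(ζ₂₄)` and the `1`-orientation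
  `Θ` of its G-type (`deg_Θ = [3 < 2·deg_Π]`) with `MT(V³_Π)(ℂ) < MT(V¹_Θ)(ℂ)` and `Hg(V³_Π)(ℂ) < Hg(V¹_Θ)(ℂ)` (STRICT), `dim M_φ̃ = 4 < 5`.
* **`exists_isIrreducible_mumfordTateGroupBaseChange_lt_gType`** — an irreducible CY-type (`h^{3,0} = 1`) weight-three SCMpHS `V` on `ℚ(ζ₂₄)`
  with `MT(V)(ℂ) < MT(J_G(V))(ℂ)`, `Hg(V)(ℂ) < Hg(J_G(V))(ℂ)` and `MT(J_W(V))(ℂ) ≤ MT(J_G(V))(ℂ)` (`J_G`, `J_W` = the weight-one structures of the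
  G- and W-types of g24-#1).

HONEST SCOPE.  Existential statements (the orientation is g26-#7's `orientationPi ι galEquiv _` for an embedding `ι`); point groups over
`ℂ` inside `GL(ℂ ⊗ ℚ(ζ₂₄))`; conditional on the tree's standing `HodgeTensorFacts` like every Mumford–Tate statement of the lane.

## References
* [GreenGriffithsKerr2012] M. Green, P. Griffiths, M. Kerr, *Mumford–Tate Groups and Domains: Their Geometry and Arithmetic*, Ann. of
  Math. Stud. 183 (2012): (V.A.10) p. 158, (V.A.4) p. 156, (V.D.5) p. 164, (V.D.7)–(V.D.8) pp. 165–166.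
* [Deligne1982HodgeCycles] P. Deligne, *Hodge cycles on abelian varieties*, LNM 900 (1982), I Ex. 3.7 (c).
-/

noncomputable section

open scoped TensorProduct Classical Pointwise
open Module NumberField

namespace Literature.AlgebraicGeometry.Motives

namespace HodgeStructure

namespace Orientation

namespace CyclotomicTwentyFour

open Literature.NumberTheory.ComplexMultiplication Literature.NumberTheory.ComplexMultiplication.CounterexampleVA10
open CounterexampleVA10

/-- `ℚ(ζ₂₄)` is the `24`-th cyclotomic extension of `ℚ` (named term; Mathlib's instance is keyed on a variable). [folklore] -/
private theorem isCyclotomicExtension_K24' : IsCyclotomicExtension {24} ℚ K24 := CyclotomicField.isCyclotomicExtension 24 ℚ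

/-- `ℚ(ζ₂₄)/ℚ` is Galois. [folklore] -/
private theorem isGalois_K24' : IsGalois ℚ K24 :=
  haveI := isCyclotomicExtension_K24'
  IsCyclotomicExtension.isGalois {24} ℚ K24

/-- `ℚ(ζ₂₄)` is a CM field. [folklore] -/
private theorem isCMField_K24' : IsCMField K24 :=
  @IsCyclotomicExtension.Rat.isCMField K24 _ _ {24} ⟨24, Set.mem_singleton 24, by norm_num⟩ isCyclotomicExtension_K24'

/-- `3` is odd. [folklore] -/
private theorem odd_three_c24 : Odd (3 : ℤ) := ⟨1, by norm_num⟩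

variable [HodgeTensorFacts.{0, 0}]

/-- **On `ℚ(ζ₂₄)`: `MT(V³_Π)(ℂ) < MT(V¹_Θ)(ℂ)` and `Hg(V³_Π)(ℂ) < Hg(V¹_Θ)(ℂ)` for an effective `3`-orientation `Π` and its G-type `Θ`**
(`deg_Θ = [3 < 2·deg_Π]`), with `dim M_φ̃(V³_Π) = 4 < 5 = dim M_φ̃(V¹_Θ)` — Question (V.A.10) at the level of Mumford–Tate groups on an
honest cyclotomic field. [cite: GreenGriffithsKerr2012, (V.A.10) p. 158 and (V.D.5) p. 164] [cite: Deligne1982HodgeCycles, I Example 3.7 (c)] -/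
theorem exists_orientation_mumfordTateGroupBaseChange_lt :
    ∃ (Λ : Orientation K24 3) (Θ : Orientation K24 1),
      (∀ θ, 0 ≤ Λ.deg θ ∧ Λ.deg θ ≤ 3) ∧ (∀ θ, Θ.deg θ = if 3 < 2 * Λ.deg θ then 1 else 0) ∧
        (ofOrientation Λ).mumfordTateGroupBaseChange ℂ < (ofOrientation Θ).mumfordTateGroupBaseChange ℂ ∧
          (ofOrientation Λ).hodgeGroupBaseChange ℂ < (ofOrientation Θ).hodgeGroupBaseChange ℂ ∧
            (ofOrientation Λ).mtRank = 4 ∧ (ofOrientation Θ).mtRank = 5 := by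
  haveI := isGalois_K24'
  haveI := isCMField_K24'
  obtain ⟨ι⟩ : Nonempty (K24 →+* ℂ) := inferInstance
  exact ⟨orientationPi ι galEquiv galEquiv_conjGal, orientationTheta ι galEquiv galEquiv_conjGal,
    orientationPi_effective ι galEquiv galEquiv_conjGal, orientationTheta_deg ι galEquiv galEquiv_conjGal,
    mumfordTateGroupBaseChange_complex_orientationPi_lt ι galEquiv galEquiv_conjGal,
    hodgeGroupBaseChange_complex_orientationPi_lt ι galEquiv galEquiv_conjGal,
    mtRank_orientationPi ι galEquiv galEquiv_conjGal, mtRank_orientationTheta ι galEquiv galEquiv_conjGal⟩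

/-- **On `ℚ(ζ₂₄)`: an irreducible CY-type weight-three SCMpHS `V` (`h^{3,0} = 1`) with `MT(V)(ℂ) < MT(J_G(V))(ℂ)`, `Hg(V)(ℂ) < Hg(J_G(V))(ℂ)`
and `MT(J_W(V))(ℂ) ≤ MT(J_G(V))(ℂ)`** — the Mumford–Tate group of the G-Jacobian strictly contains that of `V` and contains that of the
W-Jacobian (`J_G`, `J_W` = `ofCMType` of g24-#1's G- and W-types of `Ξ(F,Π)`). [cite: GreenGriffithsKerr2012, (V.A.10) p. 158 and (V.D.7)–(V.D.8) pp. 165–166]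
[cite: Deligne1982HodgeCycles, I Example 3.7 (c)] -/
theorem exists_isIrreducible_mumfordTateGroupBaseChange_lt_gType :
    ∃ (Λ : Orientation K24 3) (h3 : Odd (3 : ℤ)),
      (ofOrientation Λ).IsIrreducible ∧ (ofOrientation Λ).hodgeNumber 3 (3 - 3) = 1 ∧
        (ofOrientation Λ).mumfordTateGroupBaseChange ℂ <
            (HodgeStructure.ofCMType ((endActionOfOrientation Λ).gType rfl h3)).mumfordTateGroupBaseChange ℂ ∧
          (ofOrientation Λ).hodgeGroupBaseChange ℂ <
              (HodgeStructure.ofCMType ((endActionOfOrientation Λ).gType rfl h3)).hodgeGroupBaseChange ℂ ∧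
            (HodgeStructure.ofCMType ((endActionOfOrientation Λ).wType rfl h3)).mumfordTateGroupBaseChange ℂ ≤
              (HodgeStructure.ofCMType ((endActionOfOrientation Λ).gType rfl h3)).mumfordTateGroupBaseChange ℂ := by
  haveI := isGalois_K24'
  haveI := isCMField_K24'
  obtain ⟨ι⟩ : Nonempty (K24 →+* ℂ) := inferInstance
  exact ⟨orientationPi ι galEquiv galEquiv_conjGal, odd_three_c24,
    isIrreducible_ofOrientation_orientationPi ι galEquiv galEquiv_conjGal, hodgeNumber_three_zero ι galEquiv galEquiv_conjGal,
    mumfordTateGroupBaseChange_complex_orientationPi_lt_gType ι galEquiv galEquiv_conjGal,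
    hodgeGroupBaseChange_complex_orientationPi_lt_gType ι galEquiv galEquiv_conjGal,
    mumfordTateGroupBaseChange_complex_wType_le_gType ι galEquiv galEquiv_conjGal⟩

end CyclotomicTwentyFour

end Orientation

end HodgeStructure

end Literature.AlgebraicGeometry.Motives
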